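import Mathlib
import HarnessLib
import Summits.HubbardSuperconductivity.HubbardSuperconductivity.Theorems.KLProgrammeKLRegimeSplitSlotsV17F
import Summits.HubbardSuperconductivity.HubbardSuperconductivity.Theorems.KLProgrammeKLRegimeSplitTwoLegCoreTDProfile

/-!
# K3 `KLRegimeTwoPointLimit` (stmt-HubbardSuperconductivity-19937), gen 7-flow (plan g16 K3-FLOW RULING F, KL STATUS l.2548): the TWO-LEG DOORS of the
# engine-flow child's stubs (e) `stub_twoLeg_step` / (M) `stub_twoLeg_scale0` for p2's slot `TwoLegStepV17F` (S1, `…SplitSlotsV17F`, p524744)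

Cell gate-hubbard-kl, seat hubbard-kl-r2d-p1 (g5).  Under scheme F the two-leg slot is
`TwoLegStepV17F … n := TwoLegReadJetsF … n ∧ TwoLegSlopes … (klFlowFrameU … n) n ∧ TwoLegVolumeRateF (histV17F ∧ slopes) … n` — NO frame-Lipschitz comparison class,
NO multi-slot sizes (the CT apparatus of the `…TwoLegStepSuccDoor*` family is banked).  This file assembles the slot at ANY package `(G, Q)` and ANY scale `n`
from three suppliers:

* §1 the flow frame is DEGREE-CAPPED for free: `deg K_n ≤ 2·klFlowDeg n = 2⁸·4ⁿ` (`jacksonFrame d ·` has degree `d + d`, `deg (A ⊖ B) = max`), hence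
  `FrameOK … K_n ∧ n ≤ N + 1 ⇒ FrameOKDeg … K_n` (`frameOKDeg_klFlowFrameU`) — every capped-frame lemma of the CT lineage instantiates at `K := K_n`;
* §2 (A) `TwoLegReadJetsF` from the `C⁴` clause + the order-`≤ 4` ANGULAR jets of the cumulative reading at tables `cN ≤ G.S`, `cN' ≤ Q.S'`
  (`curveJetBar_mono` alone — the slot reads angular jets, so no chain rule and no `klJetX` division, cf. (R25)/§129 for the CT keying);
* §3 (B) `TwoLegSlopes … K_n n` = p1b's `twoLegSlopes_of_sepTubeGradient` at the flow frame (shell field strength + shell-tube gradient of the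
  `K_n`-separated reading + the fit `m₁' + 4/3·Gfr₁U² ≤ cz|U|·cDtmin/2`);
* §4 (C) `TwoLegVolumeRateF` from TWO NESTED LEGS through the common multiple — a GENERIC four-leg estimate for any volume-indexed reading and history
  (`volumeRate_of_nestedLegs_generic`; k3c4-p1's `twoLegVolumeRateAT_of_nestedLegs` route `(L,M) → (L,M⁺) → (L·L′,M⁺) ← (L′,M⁺) ← (L′,M′)`), instantiated with
  each volume read at ITS OWN flow frame (`twoLegVolumeRateF_of_nestedLegs[_quarter]`, cutoff-free form);
* §5 the assembly `twoLegStepV17F_of_conjuncts` / `twoLegStepV17F_of_jets_slopes_nestedLegs`.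

The doors under the stub binders (threshold currencies, the scale-`0` form) are in `…EngineTwoLegStepV17FDoorPkg`.  Proofs only (compositions and
elementary arithmetic); no definitions; nothing about the model is asserted; nothing asserts superconductivity.  References: BGM 2006 §2.4 (2.23)/(2.36)
[cite: BenfattoGiulianiMastropietro2006]; KL STATUS 2026-08-27 l.2548 (ruling F), l.2568 (R28) S4(a) map; residual table HOME/hubbard-kl-r2d-p1/RESIDUAL-TABLE-e-V17F.md.
-/

noncomputable section

namespace Summit.HubbardSuperconductivity.HubbardSuperconductivity.Theorems.EngineV8

set_option linter.dupNamespace false -- summit = problem name (single-conjunct summit), D-0017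

open Real Finset Literature.MathematicalPhysics.QuantumLattice Literature.Probability.LatticeModels
open Literature.MathematicalPhysics.QuantumLattice.FermiRG Literature.MathematicalPhysics.QuantumLattice.BandSectorCounting
open Summit.HubbardSuperconductivity.HubbardSuperconductivity.Theorems.KLProgrammeLegKernels
open Summit.HubbardSuperconductivity.HubbardSuperconductivity.Theorems.DispersionFlow
open Summit.HubbardSuperconductivity.HubbardSuperconductivity.Theorems.PerturbedFermiCurve
open Summit.HubbardSuperconductivity.HubbardSuperconductivity.Theorems.KLRegimeSplit

/-! ## §1 The flow frame is degree-capped (the `FrameOKDeg` input of the slopes lemma, derived inside — plan g16 (R28) (ρF-2) «else») -/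

section Degree

variable (L M : ℕ) [NeZero L] [NeZero M]

/-- The Jackson piece extractor of degree schedule `klFlowDeg` produces frames of degree `2·klFlowDeg n` (`jacksonFrame d ·` has degree `d + d`). -/
theorem degree_klFlowPieceJackson (β U μ : ℝ) (n : ℕ) (K : TrigPolyC4v) :
    (klFlowPieceJackson L M β U μ n K).degree = 2 * klFlowDeg n := by
  unfold klFlowPieceJackson jacksonFrame
  ring

/-- The degree schedule is monotone: `klFlowDeg m ≤ klFlowDeg n` for `m ≤ n`. -/
theorem klFlowDeg_mono {m n : ℕ} (h : m ≤ n) : klFlowDeg m ≤ klFlowDeg n := by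
  unfold klFlowDeg
  exact Nat.mul_le_mul_left _ (Nat.pow_le_pow_right (by norm_num) h)

/-- **The flow frame `K_n` has degree `≤ 2·klFlowDeg n = 2⁸·4ⁿ`** (`K₀ = 0`; `deg (A ⊖ B) = max (deg A) (deg B)`; the pieces `m < n` have degree
`2·klFlowDeg m ≤ 2·klFlowDeg n`). -/
theorem degree_klFlowFrameU_le (β U μ : ℝ) (n : ℕ) : (klFlowFrameU L M β U μ n).degree ≤ 2 * klFlowDeg n := by
  induction n with
  | zero => simp [klFlowFrameU_zero]
  | succ n ih =>
    rw [klFlowFrameU_succ]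
    change max (klFlowFrameU L M β U μ n).degree (klFlowPiece L M β U μ n).degree ≤ _
    refine max_le (ih.trans (Nat.mul_le_mul_left _ (klFlowDeg_mono (Nat.le_succ n)))) ?_
    unfold klFlowPiece
    rw [degree_klFlowPieceJackson]
    exact Nat.mul_le_mul_left _ (klFlowDeg_mono (Nat.le_succ n))

/-- **… hence within the engine's degree cap**: `deg K_n ≤ klFrameDeg N = 2²¹·16ᴺ` for every `n ≤ N + 1` (indeed `2⁸·4ⁿ ≤ 2⁸·4^{N+1} ≤ 2²¹·16ᴺ`). -/
theorem degree_klFlowFrameU_le_klFrameDeg (β U μ : ℝ) {n N : ℕ} (hn : n ≤ N + 1) :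
    (klFlowFrameU L M β U μ n).degree ≤ klFrameDeg N := by
  refine (degree_klFlowFrameU_le L M β U μ n).trans ?_
  unfold klFlowDeg klFrameDeg
  have h4 : 4 ^ n ≤ 4 ^ (N + 1) := Nat.pow_le_pow_right (by norm_num) hn
  have h16 : 4 ^ N ≤ 16 ^ N := Nat.pow_le_pow_left (by norm_num) N
  calc 2 * (2 ^ 7 * 4 ^ n) ≤ 2 * (2 ^ 7 * 4 ^ (N + 1)) := by gcongr
    _ = 2 ^ 10 * 4 ^ N := by rw [pow_succ]; ring
    _ ≤ 2 ^ 21 * 16 ^ N := Nat.mul_le_mul (by norm_num) h16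

variable {L M}

/-- **`FrameOKDeg R U N μ K_n` from `FrameOK R U N μ K_n`** for `n ≤ N + 1`: the flow frame is automatically within the degree cap, so every capped-frame
door of the CT lineage (exact reproduction by `symInterp`, p1b's slopes lemma) instantiates at the flow frame. -/
theorem frameOKDeg_klFlowFrameU {R : RenConsts} {U : ℝ} {N : ℕ} {μ β : ℝ} {n : ℕ} (hK : FrameOK R U N μ (klFlowFrameU L M β U μ n))
    (hn : n ≤ N + 1) : FrameOKDeg R U N μ (klFlowFrameU L M β U μ n) :=
  frameOKDeg_of hK (degree_klFlowFrameU_le_klFrameDeg L M β U μ hn)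

end Degree

/-! ## §2 Conjunct (A): the cumulative-reading jets at the package bars from a jet bound at smaller tables (`curveJetBar_mono` alone — no chain rule, no
`klJetX` division: the V17F slot reads ANGULAR jets) -/

section ReadJets

variable {L M : ℕ} [NeZero L] [NeZero M]

/-- **(A) `TwoLegReadJetsF L M G Q … n` from the `C⁴` clause and the order-`≤ 4` angular jets of the cumulative reading at tables `cN, cN'` dominated by
the package's size fields** (`cN k ≤ G.S k`, `cN' k ≤ Q.S' k`; e.g. `cN := klC4aJetC`, `cN' := klC4aJetC' P R` and k3c2-p2's package inequalities). -/
theorem twoLegReadJetsF_of_jets (G : GeoConsts) (Q : EngConsts) {β U μ : ℝ} {n : ℕ} {cN cN' : ℕ → ℝ}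
    (hpk : ∀ k, cN k ≤ G.S k) (hpk' : ∀ k, cN' k ≤ Q.S' k)
    (hC : ContDiff ℝ 4 (fun θ : ℝ => klLocalPart L M β U μ (klFlowFrameU L M β U μ n) n θ))
    (hjets : ∀ k ≤ 4, ∀ θ : ℝ,
      |iteratedDeriv k (fun θ : ℝ => klLocalPart L M β U μ (klFlowFrameU L M β U μ n) n θ) θ| ≤ curveJetBar cN cN' U k n) :
    TwoLegReadJetsF L M G Q β U μ n :=
  ⟨hC, fun k hk θ => (hjets k hk θ).trans (curveJetBar_mono hpk hpk' U k n)⟩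

/-- **(A) at the package's own tables** (no inequalities): the slot text is literally the `C⁴` clause and the jets at `curveJetBar G.S Q.S' U k n`. -/
theorem twoLegReadJetsF_of_jets_self (G : GeoConsts) (Q : EngConsts) {β U μ : ℝ} {n : ℕ}
    (hC : ContDiff ℝ 4 (fun θ : ℝ => klLocalPart L M β U μ (klFlowFrameU L M β U μ n) n θ))
    (hjets : ∀ k ≤ 4, ∀ θ : ℝ,
      |iteratedDeriv k (fun θ : ℝ => klLocalPart L M β U μ (klFlowFrameU L M β U μ n) n θ) θ| ≤ curveJetBar G.S Q.S' U k n) :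
    TwoLegReadJetsF L M G Q β U μ n :=
  ⟨hC, hjets⟩

/-- **(A) is monotone in the package's size fields.** -/
theorem TwoLegReadJetsF.mono {G G' : GeoConsts} {Q Q' : EngConsts} (hS : ∀ k, G.S k ≤ G'.S k) (hS' : ∀ k, Q.S' k ≤ Q'.S' k) {β U μ : ℝ}
    {n : ℕ} (h : TwoLegReadJetsF L M G Q β U μ n) : TwoLegReadJetsF L M G' Q' β U μ n :=
  twoLegReadJetsF_of_jets G' Q' hS hS' h.1 h.2

end ReadJets

/-! ## §3 Conjunct (B): the slopes at the flow frame (p1b's `twoLegSlopes_of_sepTubeGradient` at `K := K_n`, the degree cap derived) -/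

section Slopes

variable {L M : ℕ} [NeZero L] [NeZero M]

/-- **(B) `TwoLegSlopes R … K_n n` at the flow frame** from the field strength on the scale-`n` shell and the shell-tube gradient `m₁'` of the
`K_n`-separated reading, with the fit `m₁' + 4/3·Gfr₁U² ≤ cz|U|·cDtmin(−1.2)(−0.05)/2` (p1b's lemma; the `FrameOKDeg` hypothesis is discharged by
`frameOKDeg_klFlowFrameU` from `FrameOK … K_n` and `n ≤ nScales β + 1`). -/
theorem twoLegSlopes_flowFrame_of_sepTubeGradient {R : RenConsts} (hR : ∀ j, 0 ≤ R.Gfr j) {c : ℝ} (hc : 0 < c)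
    (hcle : c ≤ klCurveC3 R) {U : ℝ} (hU : 0 < U) (hUle : U ≤ klCurveU0 R) {β : ℝ} (hβmin : klBetaMin ≤ β)
    (hβc : β ≤ Real.exp (c / U ^ 2)) {μ : ℝ} (hμ : μ ∈ klWindowC) {n : ℕ} (hn : n ≤ nScales β + 1)
    (hK : FrameOK R U (nScales β) μ (klFlowFrameU L M β U μ n)) (hL : klEngL₃ β U ≤ L)
    (hz : ∀ k ∈ klShell L μ (klFlowFrameU L M β U μ n) n,
      |klFieldStrength L M β U μ (klFlowFrameU L M β U μ n) n k - 1| ≤ R.cz * |U|)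
    {m₁' : ℝ}
    (hm₁' : ∀ q : Momentum, |frameLevel μ (klFlowFrameU L M β U μ n) q| ≤ klScale klE0 n →
      ‖fderiv ℝ (evalM (symInterp L (fun p => klLocSelfEnergyRe L M β U μ (klFlowFrameU L M β U μ n) n p -
        (klFlowFrameU L M β U μ n).eval (latticeMomentum L p)))) q‖ ≤ m₁')
    (hfit1 : m₁' + 4 / 3 * R.Gfr 1 * U ^ 2 ≤ R.cz * |U| * (cDtmin (-1.2) (-0.05) / 2)) :
    TwoLegSlopes L M R β U μ (klFlowFrameU L M β U μ n) n :=
  twoLegSlopes_of_sepTubeGradient hR hc hcle hU hUle hβmin hβc hμ (frameOKDeg_klFlowFrameU hK hn) hL n hz hm₁' hfit1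

end Slopes

/-! ## §4 Conjunct (C): the two-volume rate at the flow frames OF EACH VOLUME from two nested legs through the common multiple
(twin of k3c4-p1's `twoLegVolumeRateAT_of_nestedLegs`; the frames live inside the readings, so the route is unchanged:
`(L,M) → (L,M⁺) → (L·L′,M⁺) ← (L′,M⁺) ← (L′,M′)`, `M⁺ := max (max M M′) (max (max (Q.M0 β (L·L′)) (Mq (L·L′))) 1)`) -/

section VolumeRate

variable {L M : ℕ} [NeZero L] [NeZero M]

/-- **A GENERIC four-leg estimate through the common multiple**, for any volume-indexed reading `rd` and any volume-indexed history `hist` read above two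
thresholds `thr`, `Mq`: a CUTOFF leg `|rd (L₁,M₁) − rd (L₁,M₂)| ≤ a/L₁` (`M₁ ≤ M₂`, fixed `L₁ ≥ L`) and a SPATIAL NESTED leg `|rd (L₁,M₂) − rd (L₂,M₂)| ≤ b/L₁`
(`L₁ ∣ L₂`) with `2a + 2b ≤ C` give `|rd (L,M) − rd (L′,M′)| ≤ C/L` against every comparison volume clearing the thresholds, given the history at every
volume from `L` up.  (The two V16/V17F slot texts are instances: `rd` = the scale-`n` local part at a fixed frame / at each volume's own flow frame.) -/
theorem volumeRate_of_nestedLegs_generic {rd : (L' M' : ℕ) → [NeZero L'] → [NeZero M'] → ℝ → ℝ}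
    {hist : (L' M' : ℕ) → [NeZero L'] → [NeZero M'] → ℕ → Prop} {thr : ℕ → ℕ} {n : ℕ} {a b C : ℝ} (ha : 0 ≤ a) (hb : 0 ≤ b)
    (hab : 2 * a + 2 * b ≤ C)
    (hcut : ∀ (Mq : ℕ → ℕ) (L₁ M₁ M₂ : ℕ) [NeZero L₁] [NeZero M₁] [NeZero M₂], L ≤ L₁ → thr L₁ ≤ M₁ → Mq L₁ ≤ M₁ → M₁ ≤ M₂ →
      (∀ j < n, hist L₁ M₁ j) → (∀ j < n, hist L₁ M₂ j) → ∀ θ : ℝ, |rd L₁ M₁ θ - rd L₁ M₂ θ| ≤ a / L₁)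
    (hsp : ∀ (Mq : ℕ → ℕ) (L₁ L₂ M₂ : ℕ) [NeZero L₁] [NeZero L₂] [NeZero M₂], L ≤ L₁ → L₁ ∣ L₂ → thr L₁ ≤ M₂ → Mq L₁ ≤ M₂ →
      thr L₂ ≤ M₂ → Mq L₂ ≤ M₂ → (∀ j < n, hist L₁ M₂ j) → (∀ j < n, hist L₂ M₂ j) → ∀ θ : ℝ, |rd L₁ M₂ θ - rd L₂ M₂ θ| ≤ b / L₁)
    (Mq : ℕ → ℕ) (hM : thr L ≤ M) (hMq : Mq L ≤ M)
    (hAll : ∀ (L'' M'' : ℕ) [NeZero L''] [NeZero M''], L ≤ L'' → thr L'' ≤ M'' → Mq L'' ≤ M'' → ∀ j < n, hist L'' M'' j)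
    (L' M' : ℕ) [NeZero L'] [NeZero M'] (hLL' : L ≤ L') (hM' : thr L' ≤ M') (hMq' : Mq L' ≤ M') (θ : ℝ) :
    |rd L M θ - rd L' M' θ| ≤ C / L := by
  have hL0 : 0 < L := Nat.pos_of_ne_zero (NeZero.ne L)
  have hL'0 : 0 < L' := Nat.pos_of_ne_zero (NeZero.ne L')
  set Lp : ℕ := L * L' with hLp
  haveI : NeZero Lp := ⟨(Nat.mul_pos hL0 hL'0).ne'⟩
  set Mp : ℕ := max (max M M') (max (max (thr Lp) (Mq Lp)) 1) with hMp
  haveI : NeZero Mp := ⟨by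
    have : 1 ≤ Mp := (le_max_right _ _).trans (le_max_right _ _)
    omega⟩
  have hMMp : M ≤ Mp := (le_max_left _ _).trans (le_max_left _ _)
  have hM'Mp : M' ≤ Mp := (le_max_right _ _).trans (le_max_left _ _)
  have hM0Lp : thr Lp ≤ Mp := ((le_max_left _ _).trans (le_max_left _ _)).trans (le_max_right _ _)
  have hMqLp : Mq Lp ≤ Mp := ((le_max_right _ _).trans (le_max_left _ _)).trans (le_max_right _ _)
  have hM0L_Mp : thr L ≤ Mp := hM.trans hMMp
  have hMqL_Mp : Mq L ≤ Mp := hMq.trans hMMp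
  have hM0L'_Mp : thr L' ≤ Mp := hM'.trans hM'Mp
  have hMqL'_Mp : Mq L' ≤ Mp := hMq'.trans hM'Mp
  have hLLp : L ≤ Lp := by rw [hLp]; exact Nat.le_mul_of_pos_right L hL'0
  have hLdvd : L ∣ Lp := Dvd.intro L' rfl
  have hL'dvd : L' ∣ Lp := Dvd.intro_left L rfl
  have hH_LM : ∀ j < n, hist L M j := hAll L M le_rfl hM hMq
  have hH_LMp : ∀ j < n, hist L Mp j := hAll L Mp le_rfl hM0L_Mp hMqL_Mp
  have hH_LpMp : ∀ j < n, hist Lp Mp j := hAll Lp Mp hLLp hM0Lp hMqLp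
  have hH_L'Mp : ∀ j < n, hist L' Mp j := hAll L' Mp hLL' hM0L'_Mp hMqL'_Mp
  have hH_L'M' : ∀ j < n, hist L' M' j := hAll L' M' hLL' hM' hMq'
  have h1 : |rd L M θ - rd L Mp θ| ≤ a / L := hcut Mq L M Mp le_rfl hM hMq hMMp hH_LM hH_LMp θ
  have h2 : |rd L Mp θ - rd Lp Mp θ| ≤ b / L := hsp Mq L Lp Mp le_rfl hLdvd hM0L_Mp hMqL_Mp hM0Lp hMqLp hH_LMp hH_LpMp θ
  have h3 : |rd L' Mp θ - rd Lp Mp θ| ≤ b / L' := hsp Mq L' Lp Mp hLL' hL'dvd hM0L'_Mp hMqL'_Mp hM0Lp hMqLp hH_L'Mp hH_LpMp θ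
  have h4 : |rd L' M' θ - rd L' Mp θ| ≤ a / L' := hcut Mq L' M' Mp hLL' hM' hMq' hM'Mp hH_L'M' hH_L'Mp θ
  have hLR : (0 : ℝ) < L := by exact_mod_cast hL0
  have hLL'R : (L : ℝ) ≤ L' := by exact_mod_cast hLL'
  have h3' : |rd L' Mp θ - rd Lp Mp θ| ≤ b / L := h3.trans (div_le_div_of_nonneg_left hb hLR hLL'R)
  have h4' : |rd L' M' θ - rd L' Mp θ| ≤ a / L := h4.trans (div_le_div_of_nonneg_left ha hLR hLL'R)
  have key : |rd L M θ - rd L' M' θ| ≤ a / L + b / L + b / L + a / L := by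
    have e : rd L M θ - rd L' M' θ =
        (rd L M θ - rd L Mp θ) + (rd L Mp θ - rd Lp Mp θ) - (rd L' Mp θ - rd Lp Mp θ) - (rd L' M' θ - rd L' Mp θ) := by ring
    rw [e]
    exact (abs_sub _ _).trans (add_le_add ((abs_sub _ _).trans (add_le_add ((abs_add_le _ _).trans (add_le_add h1 h2)) h3')) h4')
  refine key.trans ?_
  rw [show a / L + b / L + b / L + a / L = (2 * a + 2 * b) / L by ring]
  exact div_le_div_of_nonneg_right hab hLR.le

variable {hist : (L' M' : ℕ) → [NeZero L'] → [NeZero M'] → ℕ → Prop} {Q : EngConsts} {β U μ : ℝ} {n : ℕ}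

/-- **(C) (E3f-F) `TwoLegVolumeRateF` FROM TWO NESTED LEGS, uniformly in the reader's threshold `Mq`** — each volume read at ITS OWN flow frame:
(i) CUTOFF leg at fixed `L₁ ≥ L`: `|ν_n^{L₁,M₁}(K_n^{L₁,M₁}) − ν_n^{L₁,M₂}(K_n^{L₁,M₂})| ≤ a/L₁` for `M₁ ≤ M₂` above both thresholds, history at both;
(ii) SPATIAL NESTED leg at common cutoff: `L₁ ∣ L₂`, thresholds at `L₁` and `L₂` below `M₂`, history at both ⇒ `≤ b/L₁`; `2a + 2b ≤ Q.CL β n`. -/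
theorem twoLegVolumeRateF_of_nestedLegs {a b : ℝ} (ha : 0 ≤ a) (hb : 0 ≤ b) (hab : 2 * a + 2 * b ≤ Q.CL β n)
    (hcut : ∀ (Mq : ℕ → ℕ) (L₁ M₁ M₂ : ℕ) [NeZero L₁] [NeZero M₁] [NeZero M₂], L ≤ L₁ → Q.M0 β L₁ ≤ M₁ → Mq L₁ ≤ M₁ → M₁ ≤ M₂ →
      (∀ j < n, hist L₁ M₁ j) → (∀ j < n, hist L₁ M₂ j) →
        ∀ θ : ℝ, |klLocalPart L₁ M₁ β U μ (klFlowFrameU L₁ M₁ β U μ n) n θ -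
          klLocalPart L₁ M₂ β U μ (klFlowFrameU L₁ M₂ β U μ n) n θ| ≤ a / L₁)
    (hsp : ∀ (Mq : ℕ → ℕ) (L₁ L₂ M₂ : ℕ) [NeZero L₁] [NeZero L₂] [NeZero M₂], L ≤ L₁ → L₁ ∣ L₂ → Q.M0 β L₁ ≤ M₂ → Mq L₁ ≤ M₂ →
      Q.M0 β L₂ ≤ M₂ → Mq L₂ ≤ M₂ → (∀ j < n, hist L₁ M₂ j) → (∀ j < n, hist L₂ M₂ j) →
        ∀ θ : ℝ, |klLocalPart L₁ M₂ β U μ (klFlowFrameU L₁ M₂ β U μ n) n θ -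
          klLocalPart L₂ M₂ β U μ (klFlowFrameU L₂ M₂ β U μ n) n θ| ≤ b / L₁) :
    TwoLegVolumeRateF L M hist Q β U μ n := by
  intro Mq hM hMq hAll L' M' _ _ hLL' hM' hMq' θ
  exact volumeRate_of_nestedLegs_generic (rd := fun L' M' _ _ θ => klLocalPart L' M' β U μ (klFlowFrameU L' M' β U μ n) n θ)
    (thr := Q.M0 β) ha hb hab hcut hsp Mq hM hMq hAll L' M' hLL' hM' hMq' θ

/-- **(C) from two nested legs, quarter-budget form**: legs `≤ Q.CL β n / 4 / L₁` each. -/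
theorem twoLegVolumeRateF_of_nestedLegs_quarter (hCL : 0 ≤ Q.CL β n)
    (hcut : ∀ (Mq : ℕ → ℕ) (L₁ M₁ M₂ : ℕ) [NeZero L₁] [NeZero M₁] [NeZero M₂], L ≤ L₁ → Q.M0 β L₁ ≤ M₁ → Mq L₁ ≤ M₁ → M₁ ≤ M₂ →
      (∀ j < n, hist L₁ M₁ j) → (∀ j < n, hist L₁ M₂ j) →
        ∀ θ : ℝ, |klLocalPart L₁ M₁ β U μ (klFlowFrameU L₁ M₁ β U μ n) n θ -
          klLocalPart L₁ M₂ β U μ (klFlowFrameU L₁ M₂ β U μ n) n θ| ≤ Q.CL β n / 4 / L₁)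
    (hsp : ∀ (Mq : ℕ → ℕ) (L₁ L₂ M₂ : ℕ) [NeZero L₁] [NeZero L₂] [NeZero M₂], L ≤ L₁ → L₁ ∣ L₂ → Q.M0 β L₁ ≤ M₂ → Mq L₁ ≤ M₂ →
      Q.M0 β L₂ ≤ M₂ → Mq L₂ ≤ M₂ → (∀ j < n, hist L₁ M₂ j) → (∀ j < n, hist L₂ M₂ j) →
        ∀ θ : ℝ, |klLocalPart L₁ M₂ β U μ (klFlowFrameU L₁ M₂ β U μ n) n θ -
          klLocalPart L₂ M₂ β U μ (klFlowFrameU L₂ M₂ β U μ n) n θ| ≤ Q.CL β n / 4 / L₁) :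
    TwoLegVolumeRateF L M hist Q β U μ n :=
  twoLegVolumeRateF_of_nestedLegs (a := Q.CL β n / 4) (b := Q.CL β n / 4) (by positivity) (by positivity) (by linarith) hcut hsp

/-- **Cutoff-free form**: if the scale-`n` reading is EXACTLY cutoff-independent above the thresholds (flow frame included), only the spatial leg
(half budget) is owed. -/
theorem twoLegVolumeRateF_of_cutoffFree_nested (hCL : 0 ≤ Q.CL β n)
    (hcut : ∀ (Mq : ℕ → ℕ) (L₁ M₁ M₂ : ℕ) [NeZero L₁] [NeZero M₁] [NeZero M₂], L ≤ L₁ → Q.M0 β L₁ ≤ M₁ → Mq L₁ ≤ M₁ → M₁ ≤ M₂ →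
      (∀ j < n, hist L₁ M₁ j) → (∀ j < n, hist L₁ M₂ j) →
        ∀ θ : ℝ, klLocalPart L₁ M₁ β U μ (klFlowFrameU L₁ M₁ β U μ n) n θ = klLocalPart L₁ M₂ β U μ (klFlowFrameU L₁ M₂ β U μ n) n θ)
    (hsp : ∀ (Mq : ℕ → ℕ) (L₁ L₂ M₂ : ℕ) [NeZero L₁] [NeZero L₂] [NeZero M₂], L ≤ L₁ → L₁ ∣ L₂ → Q.M0 β L₁ ≤ M₂ → Mq L₁ ≤ M₂ →
      Q.M0 β L₂ ≤ M₂ → Mq L₂ ≤ M₂ → (∀ j < n, hist L₁ M₂ j) → (∀ j < n, hist L₂ M₂ j) →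
        ∀ θ : ℝ, |klLocalPart L₁ M₂ β U μ (klFlowFrameU L₁ M₂ β U μ n) n θ -
          klLocalPart L₂ M₂ β U μ (klFlowFrameU L₂ M₂ β U μ n) n θ| ≤ Q.CL β n / 2 / L₁) :
    TwoLegVolumeRateF L M hist Q β U μ n :=
  twoLegVolumeRateF_of_nestedLegs (a := 0) (b := Q.CL β n / 2) le_rfl (by positivity) (by linarith)
    (fun Mq L₁ M₁ M₂ _ _ _ hL hM₁ hMq hM₁₂ hh₁ hh₂ θ => by
      rw [hcut Mq L₁ M₁ M₂ hL hM₁ hMq hM₁₂ hh₁ hh₂ θ, sub_self, abs_zero, zero_div])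
    hsp

end VolumeRate

/-! ## §5 The assembled V17F two-leg slot at ANY package `(G, Q)` and ANY scale `n` ((M) calls it at `n = 0`, (e) at `1 ≤ n`) -/

section Assembly

variable {L M : ℕ} [NeZero L] [NeZero M] {G : GeoConsts} {P : SplitConsts} {Q : EngConsts} {R : RenConsts} {β U μ : ℝ} {n : ℕ}

/-- **`TwoLegStepV17F` from its three conjuncts** (order of the slot text). -/
theorem twoLegStepV17F_of_conjuncts (h1 : TwoLegReadJetsF L M G Q β U μ n) (h2 : TwoLegSlopes L M R β U μ (klFlowFrameU L M β U μ n) n)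
    (h3 : TwoLegVolumeRateF L M
      (fun L'' M'' _ _ j => histV17F L'' M'' G P Q R β U μ j ∧ TwoLegSlopes L'' M'' R β U μ (klFlowFrameU L'' M'' β U μ j) j) Q β U μ n) :
    TwoLegStepV17F L M G P Q R β U μ n :=
  ⟨h1, h2, h3⟩

/-- **The three conjuncts of `TwoLegStepV17F`** (converse bookkeeping). -/
theorem TwoLegStepV17F.conjuncts (h : TwoLegStepV17F L M G P Q R β U μ n) :
    TwoLegReadJetsF L M G Q β U μ n ∧ TwoLegSlopes L M R β U μ (klFlowFrameU L M β U μ n) n ∧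
      TwoLegVolumeRateF L M
        (fun L'' M'' _ _ j => histV17F L'' M'' G P Q R β U μ j ∧ TwoLegSlopes L'' M'' R β U μ (klFlowFrameU L'' M'' β U μ j) j) Q β U μ n :=
  h

/-- **The V17F slot from (A) reading jets, (B) slopes at `K_n`, and (C) two nested legs** (quarter budget; the shape the gen-7-flow `stub_twoLeg_step` /
`stub_twoLeg_scale0` provers deliver). -/
theorem twoLegStepV17F_of_jets_slopes_nestedLegs (h1 : TwoLegReadJetsF L M G Q β U μ n)
    (h2 : TwoLegSlopes L M R β U μ (klFlowFrameU L M β U μ n) n) (hCL : 0 ≤ Q.CL β n)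
    (hcut : ∀ (Mq : ℕ → ℕ) (L₁ M₁ M₂ : ℕ) [NeZero L₁] [NeZero M₁] [NeZero M₂], L ≤ L₁ → Q.M0 β L₁ ≤ M₁ → Mq L₁ ≤ M₁ → M₁ ≤ M₂ →
      (∀ j < n, histV17F L₁ M₁ G P Q R β U μ j ∧ TwoLegSlopes L₁ M₁ R β U μ (klFlowFrameU L₁ M₁ β U μ j) j) →
      (∀ j < n, histV17F L₁ M₂ G P Q R β U μ j ∧ TwoLegSlopes L₁ M₂ R β U μ (klFlowFrameU L₁ M₂ β U μ j) j) →
        ∀ θ : ℝ, |klLocalPart L₁ M₁ β U μ (klFlowFrameU L₁ M₁ β U μ n) n θ -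
          klLocalPart L₁ M₂ β U μ (klFlowFrameU L₁ M₂ β U μ n) n θ| ≤ Q.CL β n / 4 / L₁)
    (hsp : ∀ (Mq : ℕ → ℕ) (L₁ L₂ M₂ : ℕ) [NeZero L₁] [NeZero L₂] [NeZero M₂], L ≤ L₁ → L₁ ∣ L₂ → Q.M0 β L₁ ≤ M₂ → Mq L₁ ≤ M₂ →
      Q.M0 β L₂ ≤ M₂ → Mq L₂ ≤ M₂ →
      (∀ j < n, histV17F L₁ M₂ G P Q R β U μ j ∧ TwoLegSlopes L₁ M₂ R β U μ (klFlowFrameU L₁ M₂ β U μ j) j) →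
      (∀ j < n, histV17F L₂ M₂ G P Q R β U μ j ∧ TwoLegSlopes L₂ M₂ R β U μ (klFlowFrameU L₂ M₂ β U μ j) j) →
        ∀ θ : ℝ, |klLocalPart L₁ M₂ β U μ (klFlowFrameU L₁ M₂ β U μ n) n θ -
          klLocalPart L₂ M₂ β U μ (klFlowFrameU L₂ M₂ β U μ n) n θ| ≤ Q.CL β n / 4 / L₁) :
    TwoLegStepV17F L M G P Q R β U μ n :=
  twoLegStepV17F_of_conjuncts h1 h2 (twoLegVolumeRateF_of_nestedLegs_quarter hCL hcut hsp)

end Assembly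

end Summit.HubbardSuperconductivity.HubbardSuperconductivity.Theorems.EngineV8

end
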